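import Summits.BirchSwinnertonDyer.BirchSwinnertonDyer.Theorems.EisensteinDepletionAtTwoStarOptBNSFOddShimuraCover
import Summits.BirchSwinnertonDyer.BirchSwinnertonDyer.Theorems.ByReductionTypeAtTwoOrdIsogenyRescale
import Literature.NumberTheory.EllipticCurves.LatticeInclusionIsogenyComplexPointsProofs
import Literature.NumberTheory.EllipticCurves.PeriodLatticeRationalityUnconditionalProofs
import Literature.NumberTheory.EllipticCurves.IsogenyFaltingsLFunctionProofs
import Literature.NumberTheory.EllipticCurves.GlobalMinimalModelProofs
import Literature.NumberTheory.EllipticCurves.EichlerShimuraConstructionProofs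
import Literature.NumberTheory.EllipticCurves.IsogenyVariableChangeProofs
import Literature.NumberTheory.EllipticCurves.IsogenyCompProofs
import Literature.NumberTheory.EllipticCurves.IsogenyDualProofs
import Literature.NumberTheory.EllipticCurves.ModularCurveManinSemistableBridgeProofs
import Literature.NumberTheory.EllipticCurves.AnalyticIsogenyDescentProofs
import HarnessLib

/-!
# Route `EisensteinDepletionAtTwo`, crux `StarOptBNSF` (item stmt-BirchSwinnertonDyer-27047), line `nsf` v9 —
# the CONVERSE transport: «no formal rational 2-torsion on the `X₀(N)`-optimal curve» (P-E₀, ordinary form)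
# IMPLIES «Stevens' conjecture at 2 for the `X₁(N)`-optimal curve» (the v9 research stub), at traceless levels

Cell `bsd-rank2` (HOME run/shared/lean/pub/bsd-rank2/), seat `bsd-rank2-eng-2` GEN 18 (task T2 of STATUS
2026-08-28T13:2xZ; planner p2 GEN 33's «optional converse», lead star-p1 GEN 8's «30-line twin»).  HONEST
FRAMING: bookkeeping for an OPEN crux child; nothing here reads an analytic rank; `StarOptBNSF` / `E1M_NSF` /
BSD are NOT proved (PARTITION D-0054: none — r_an ≥ 2, summit axis S0).

Line `nsf` v9 (registered 13:12Z) reads `StarOptBNSF ⇐ stub_stevensAtTwoX1 ∧ stub_x1Optimal`, and the lead's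
tree theorem `ShimuraCover.not_exists_ramified_of_gamma1Optimal` transports «no formal rational 2-torsion» from
the `X₁(N)`-optimal curve `W₁` (Néron lattice `c₁Λ₁(f)`) DOWN the odd Shimura cover to the `X₀(N)`-optimal
curve `W₀` (Néron lattice `qΛ_f`).  This file proves the OPPOSITE transport and packages it as the implication
«v8's P-E₀ (ordinary form) ⇒ v9's `stub_stevensAtTwoX1`» WITHOUT any print stub: the `X₀(N)`-optimal curve
needed on the way EXISTS in the tree (Eichler–Shimura short model `ℂ/Λ_f` over `ℚ`,
`IsNewform0.exists_shortModel_periodLattice`, moved to a global minimal model by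
`hasGlobalMinimalModel_rat_holds`; its newform is `f` because it is `ℚ`-isogenous to `W₁` by the analytic
descent of the lattice inclusion `c₁⁻¹·Λ_{W₁} = Λ₁(f) ⊆ Λ_f`).  Consequently the card's «Stevens-at-2(E₁) ⟺
P-E₀ at traceless levels» is kernel-exact in the direction that lets p2's census F4 (0 / 44 690 classes,
PE0-CENSUS.md) count VERBATIM as a falsifier pass of the registered research stub `stub_stevensAtTwoX1`.

* `exists_isogeny_odd_degree_toX0Optimal` — the odd cover in the direction `W₁ → W₀` (multiplier `q/c₁`:
  `(q/c₁)·c₁Λ₁(f) = qΛ₁(f) ⊆ qΛ_f`, and `p·qΛ_f ⊆ qΛ₁(f)` by Ling–Oesterlé `pΛ_f ⊆ Λ₁(f)`;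
  `exists_isogeny_odd_degree_of_isNeronLatticeOf`).
* `not_exists_ramified_of_gamma0Optimal` — twin of the lead's theorem: `W₀, W₁` globally minimal, `W₁` good
  ordinary at `2`, `W₀` without formal rational 2-torsion ⇒ `W₁` without formal rational 2-torsion
  (`OddTransportRamified.not_exists_ramified_of_isogeny_of_odd` along `W₁ → W₀`).
* `exists_gamma0Optimal_of_gamma1Lattice` — for `W₁/ℚ` elliptic with newform `f` and Néron lattice
  `c₁Λ₁(f)`: a GLOBALLY MINIMAL elliptic `W₀/ℚ` with newform `f`, Néron lattice `qΛ_f` (`q ∈ ℚˣ`), isogenous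
  to `W₁` — PROVED (no named fact).
* `stevensAtTwoX1_of_x0OptimalEtaleNSF_ord` — **P-E₀ (ordinary form, the conclusion of v9's
  `x0OptimalEtaleNSF_ord_of_stubs`) ⇒ the statement of `Holds.stub_stevensAtTwoX1` verbatim.**

References: G. Stevens, Invent. Math. 98 (1989), §2; S. Ling–J. Oesterlé, Astérisque 196–197 (1991), Thm. 6;
J. H. Silverman, *AEC* (2009), Thm. VI.4.1(b), VIII.8.3 (global minimal models over `ℚ`).
-/

set_option linter.dupNamespace false -- `Summit.BirchSwinnertonDyer.BirchSwinnertonDyer` (summit = problem, D-0017)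
set_option autoImplicit false

noncomputable section

open scoped Classical
open Literature.NumberTheory.EllipticCurves Literature.NumberTheory.EllipticCurves.Greenberg1999
open Literature.NumberTheory.EllipticCurves.ModularForms
open Summit.BirchSwinnertonDyer.BirchSwinnertonDyer.Theorems.DepletionAtTwo.OddTransportRamified

namespace Summit.BirchSwinnertonDyer.BirchSwinnertonDyer.Theorems.DepletionAtTwo.ShimuraCoverConverse

variable [Algebra (AlgebraicClosure ℚ) ℂ] [IsScalarTower ℚ (AlgebraicClosure ℚ) ℂ]

/-! ### The odd cover `W₁ → W₀` -/

/-- **Odd-degree `ℚ`-isogeny from the `X₁(N)`-lattice curve to the `X₀(N)`-lattice curve at a traceless odd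
prime.**  `f` a newform on `Γ₀(N)`, `p ∣ N` prime, `p ≠ 2`, `a_p(f) = 0`; `W₀/ℚ` elliptic with Néron period
pair `L₀` spanning `qΛ_f`, `W₁/ℚ` elliptic with Néron period pair `L₁` spanning `c₁Λ₁(f)` (`q, c₁ ∈ ℚˣ`).  Then
some `ℚ`-isogeny `W₁ → W₀` has odd degree: it is `z ↦ (q/c₁)z`, and `p` kills its kernel because
`pΛ_f ⊆ Λ₁(f)` (Ling–Oesterlé, tree `pMulLatticeLeGamma1OfTracelessPrime_holds`).
[cite: LingOesterle1991, Thm. 6 («T_p = p on Σ(N) for p ∣ N»)] [cite: SilvermanAEC2009, Thm. VI.4.1(b)] -/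
theorem exists_isogeny_odd_degree_toX0Optimal (W₀ W₁ : WeierstrassCurve ℚ) [W₀.IsElliptic]
    [W₁.IsElliptic] {N : ℕ} [NeZero N] (f : CuspForm (CongruenceSubgroup.Gamma0 N) 2) (hf : IsNewform0 f)
    {p : ℕ} (hp : p.Prime) (hp2 : p ≠ 2) (hpN : p ∣ N) (hap : cuspCoeff f p = 0)
    {L₀ L₁ : PeriodPair} (hL₀ : IsNeronLatticeOf (W₀.baseChange ℂ) L₀)
    (hL₁ : IsNeronLatticeOf (W₁.baseChange ℂ) L₁) {q c₁ : ℚ} (hq : q ≠ 0) (hc₁ : c₁ ≠ 0)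
    (hin₀ : ∀ w ∈ periodLattice f, (q : ℂ) * w ∈ L₀.lattice)
    (hout₀ : ∀ z ∈ L₀.lattice, ∃ w ∈ periodLattice f, z = (q : ℂ) * w)
    (hin₁ : ∀ w ∈ periodLatticeGamma1 f, (c₁ : ℂ) * w ∈ L₁.lattice)
    (hout₁ : ∀ z ∈ L₁.lattice, ∃ w ∈ periodLatticeGamma1 f, z = (c₁ : ℂ) * w) :
    ∃ ψ : WeierstrassCurve.Isogeny W₁ W₀, Odd ψ.degree := by
  have hc₁C : (c₁ : ℂ) ≠ 0 := by exact_mod_cast hc₁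
  have hc : q / c₁ ≠ 0 := div_ne_zero hq hc₁
  refine exists_isogeny_odd_degree_of_isNeronLatticeOf hL₁ hL₀ hc ?_ (hp.odd_of_ne_two hp2) ?_
  · -- `(q/c₁) Λ_{L₁} ⊆ Λ_{L₀}`: `(q/c₁)(c₁ w) = q w`, `w ∈ Λ₁(f) ⊆ Λ_f`
    intro z hz
    obtain ⟨w, hw, rfl⟩ := hout₁ z hz
    have h := hin₀ w (periodLatticeGamma1_le_periodLattice f hw)
    convert h using 1
    push_cast
    field_simp
  · -- `p Λ_{L₀} ⊆ (q/c₁) Λ_{L₁}`: `p (q v) = (q/c₁)(c₁ (p v))`, `p v ∈ Λ₁(f)` (Ling–Oesterlé)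
    intro w hw
    obtain ⟨v, hv, rfl⟩ := hout₀ w hw
    have hpv : (p : ℂ) * v ∈ periodLatticeGamma1 f :=
      pMulLatticeLeGamma1OfTracelessPrime_holds N f hf p hp hpN hap v hv
    refine ⟨(c₁ : ℂ) * ((p : ℂ) * v), hin₁ _ hpv, ?_⟩
    push_cast
    field_simp

/-! ### The transport of «no formal rational 2-torsion» from `E₀` to `E₁` -/

/-- **No formal rational 2-torsion on `E₀` ⇒ none on `E₁`, at a level with a traceless odd prime** (twin of
the lead's `ShimuraCover.not_exists_ramified_of_gamma1Optimal`, opposite direction).  For globally minimal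
elliptic `W₀, W₁/ℚ`, `W₁` good ordinary at `2`, a newform `f` with a traceless odd prime `p ∣ N`, Néron
lattices `L₀ = qΛ_f`, `L₁ = c₁Λ₁(f)`: if `W₀` has no rational 2-torsion abscissa ramified at `2`, then neither
has `W₁` (transport along the odd cover `W₁ → W₀`, `not_exists_ramified_of_isogeny_of_odd`).
[cite: Stevens1989, §2] [cite: LingOesterle1991, Thm. 6] -/
theorem not_exists_ramified_of_gamma0Optimal (W₀ W₁ : WeierstrassCurve ℚ) [W₀.IsElliptic]
    [W₀.IsGloballyMinimal] [W₁.IsElliptic] [W₁.IsGloballyMinimal] (hord₁ : IsOrdinaryAt W₁ 2)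
    {N : ℕ} [NeZero N] (f : CuspForm (CongruenceSubgroup.Gamma0 N) 2) (hf : IsNewform0 f)
    {p : ℕ} (hp : p.Prime) (hp2 : p ≠ 2) (hpN : p ∣ N) (hap : cuspCoeff f p = 0)
    {L₀ L₁ : PeriodPair} (hL₀ : IsNeronLatticeOf (W₀.baseChange ℂ) L₀)
    (hL₁ : IsNeronLatticeOf (W₁.baseChange ℂ) L₁) {q c₁ : ℚ} (hq : q ≠ 0) (hc₁ : c₁ ≠ 0)
    (hin₀ : ∀ w ∈ periodLattice f, (q : ℂ) * w ∈ L₀.lattice)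
    (hout₀ : ∀ z ∈ L₀.lattice, ∃ w ∈ periodLattice f, z = (q : ℂ) * w)
    (hin₁ : ∀ w ∈ periodLatticeGamma1 f, (c₁ : ℂ) * w ∈ L₁.lattice)
    (hout₁ : ∀ z ∈ L₁.lattice, ∃ w ∈ periodLatticeGamma1 f, z = (c₁ : ℂ) * w)
    (hno₀ : ¬ ∃ x₀ : ℚ, HasRationalTwoTorsionX W₀ x₀ ∧ TwoTorsionRamifiedAtTwo x₀) :
    ¬ ∃ x₁ : ℚ, HasRationalTwoTorsionX W₁ x₁ ∧ TwoTorsionRamifiedAtTwo x₁ := by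
  obtain ⟨ψ, hodd⟩ := exists_isogeny_odd_degree_toX0Optimal W₀ W₁ f hf hp hp2 hpN hap hL₀ hL₁ hq hc₁
    hin₀ hout₀ hin₁ hout₁
  exact not_exists_ramified_of_isogeny_of_odd ψ hodd hord₁ hno₀

/-! ### The `X₀(N)`-optimal curve exists (tree: Eichler–Shimura short model + global minimal model) -/

omit [Algebra (AlgebraicClosure ℚ) ℂ] [IsScalarTower ℚ (AlgebraicClosure ℚ) ℂ] in
/-- **A globally minimal `ℚ`-model of `ℂ/Λ_f` with newform `f`, for the newform of a curve with Néron lattice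
`c₁Λ₁(f)`.**  Let `W₁/ℚ` be elliptic with newform `f` (`IsNewformOf W₁ f`) and a Néron period pair `L₁` with
`c₁Λ₁(f) ⊆ Λ_{L₁} ⊆ c₁Λ_f` (`c₁ ∈ ℚˣ`; e.g. `Λ_{L₁} = c₁Λ₁(f)`).  Then there are a GLOBALLY MINIMAL elliptic
`W₀/ℚ`, a Néron period pair `L₀` of `W₀` and `q ∈ ℚˣ` with `Λ_{L₀} = qΛ_f` (both inclusions), `IsNewformOf W₀ f`,
and `W₁ ~ W₀` over `ℚ`.  Construction: `f` has rational coefficients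
(`IsNewformOf.coeffField_eq_bot_of_isNewformOf`), so the Eichler–Shimura short model `E/ℚ` with Néron lattice
`Λ_f` exists (`IsNewform0.exists_shortModel_periodLattice`); `W₁ ~ E` by the analytic descent of
`c₁⁻¹Λ_{L₁} ⊆ Λ_f` (`isIsogenous_of_forall_mul_mem_lattice`); `W₀ = C • E` globally minimal
(`hasGlobalMinimalModel_rat_holds`, Silverman VIII.8.3) has Néron lattice `uΛ_f`, `u = C.u ∈ ℚˣ`
(`IsNeronLatticeOf.smul`), and newform `f` (`IsNewformOf.of_isIsogenous`).
[cite: SilvermanAEC2009, VIII.8.3 and Thm. VI.4.1(b)] -/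
theorem exists_gamma0Optimal_of_gamma1Lattice (W₁ : WeierstrassCurve ℚ) [W₁.IsElliptic]
    {N : ℕ} [NeZero N] (f : CuspForm (CongruenceSubgroup.Gamma0 N) 2) (hW₁ : IsNewformOf W₁ f)
    {L₁ : PeriodPair} (hL₁ : IsNeronLatticeOf (W₁.baseChange ℂ) L₁) {c₁ : ℚ} (hc₁ : c₁ ≠ 0)
    (hout₁ : ∀ z ∈ L₁.lattice, ∃ w ∈ periodLattice f, z = (c₁ : ℂ) * w) :
    ∃ (W₀ : WeierstrassCurve ℚ) (_ : W₀.IsElliptic) (_ : W₀.IsGloballyMinimal) (L₀ : PeriodPair) (q : ℚ),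
      IsNewformOf W₀ f ∧ IsNeronLatticeOf (W₀.baseChange ℂ) L₀ ∧ q ≠ 0 ∧
        (∀ z ∈ periodLattice f, (q : ℂ) * z ∈ L₀.lattice) ∧
        (∀ z ∈ L₀.lattice, ∃ w ∈ periodLattice f, z = (q : ℂ) * w) ∧
        WeierstrassCurve.IsIsogenous W₁ W₀ := by
  have hc₁C : (c₁ : ℂ) ≠ 0 := by exact_mod_cast hc₁
  -- the Eichler–Shimura short model `E` with Néron lattice `Λ_f`
  have hQ : coeffField f = ⊥ := IsNewformOf.coeffField_eq_bot_of_isNewformOf hW₁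
  obtain ⟨Lf, a₄, a₆, hLf, hE, hNer⟩ := hW₁.1.exists_shortModel_periodLattice hQ
  set E : WeierstrassCurve ℚ := { a₁ := 0, a₂ := 0, a₃ := 0, a₄ := a₄, a₆ := a₆ } with hEdef
  haveI : E.IsElliptic := hE
  have hmemLf : ∀ x, x ∈ Lf.lattice ↔ x ∈ periodLattice f := fun x ↦ by
    rw [← hLf]
    rfl
  -- `W₁ ~ E` by the analytic descent of `c₁⁻¹ Λ_{L₁} ⊆ Λ_f`
  have hle₁ : ∀ z ∈ L₁.lattice, ((c₁⁻¹ : ℚ) : ℂ) * z ∈ Lf.lattice := by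
    intro z hz
    obtain ⟨w, hw, rfl⟩ := hout₁ z hz
    rw [hmemLf]
    convert hw using 1
    push_cast
    field_simp
  have hiso₁E : WeierstrassCurve.IsIsogenous W₁ E :=
    isIsogenous_of_forall_mul_mem_lattice hL₁.1 hL₁.2 hNer.1 hNer.2 (inv_ne_zero hc₁) hle₁
  -- a global minimal model `W₀ = C • E`
  obtain ⟨C, hC⟩ := WeierstrassCurve.hasGlobalMinimalModel_rat_holds E
  haveI := hC
  -- its Néron lattice `u Λ_f`
  have hmap : (C • E).baseChange ℂ = (C.map (algebraMap ℚ ℂ)) • E.baseChange ℂ := by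
    simp only [WeierstrassCurve.baseChange, WeierstrassCurve.map_variableChange]
  have hL₀ : IsNeronLatticeOf ((C • E).baseChange ℂ)
      (Lf.mulLeft ((C.map (algebraMap ℚ ℂ)).u : ℂ) (C.map (algebraMap ℚ ℂ)).u.ne_zero) := by
    rw [hmap]
    exact hNer.smul _
  have hu : (((C.map (algebraMap ℚ ℂ)).u : ℂˣ) : ℂ) = ((C.u : ℚ) : ℂ) := by
    simp [WeierstrassCurve.VariableChange.map_u]
  have huq : (C.u : ℚ) ≠ 0 := C.u.ne_zero
  have huC : ((C.u : ℚ) : ℂ) ≠ 0 := by exact_mod_cast huq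
  refine ⟨C • E, inferInstance, hC, _, (C.u : ℚ), ?_, hL₀, huq, ?_, ?_, ?_⟩
  · -- newform: `C • E ~ E ~ W₁`
    exact hW₁.of_isIsogenous
      ((WeierstrassCurve.isIsogenous_of_smul E C).trans' hiso₁E.symm_of_charZero)
  · intro z hz
    rw [← hu, PeriodPair.mul_mem_mulLeft_lattice, hmemLf]
    exact hz
  · intro z hz
    rw [PeriodPair.mem_mulLeft_lattice, hu, hmemLf] at hz
    exact ⟨_, hz, by field_simp⟩
  · exact hiso₁E.trans' (WeierstrassCurve.isIsogenous_smul E C)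

/-! ### P-E₀ (ordinary form) ⇒ Stevens at 2 for `E₁` (v9's research stub) -/

/-- **v8's P-E₀ (with the binder `IsOrdinaryAt W₀ 2`) implies v9's research stub `stub_stevensAtTwoX1`.**
Hypothesis = the conclusion of line nsf v9's `x0OptimalEtaleNSF_ord_of_stubs` VERBATIM (the `X₀(N)`-optimal
curve of a class at an odd level with a traceless prime, good ordinary at `2`, has no formal rational 2-torsion
point); conclusion = the statement of `Holds.stub_stevensAtTwoX1` VERBATIM (the `X₁(N)`-optimal curve has
none).  Proof: build the `X₀(N)`-optimal curve `W₀` of the class of `W₁` (`exists_gamma0Optimal_of_gamma1Lattice`,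
tree), transport ordinarity `W₁ ⇝ W₀` along the isogeny (`isOrdinaryAt_of_isIsogenous`), read P-E₀ at `W₀`, and
climb the odd cover `W₁ → W₀` (`not_exists_ramified_of_gamma0Optimal`).  With the lead's
`not_exists_ramified_of_gamma1Optimal` (other direction, modulo the print stub `stub_x1Optimal`) this makes the
card's «Stevens-at-2(E₁) ⟺ P-E₀ at traceless levels» a tree equivalence, so the P-E₀ census (p2 GEN 33 F4:
0 / 44 690) is a falsifier pass of the registered research stub. [cite: Stevens1989, §2]
[cite: LingOesterle1991, Thm. 6] -/
theorem stevensAtTwoX1_of_x0OptimalEtaleNSF_ord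
    (hP : ∀ (W₀ : WeierstrassCurve ℚ) [W₀.IsElliptic] [W₀.IsGloballyMinimal]
      ⦃N : ℕ⦄ [NeZero N] (f : CuspForm (CongruenceSubgroup.Gamma0 N) 2), IsNewformOf W₀ f →
      ¬ 2 ∣ N → (∃ p : ℕ, p.Prime ∧ p ∣ N ∧ cuspCoeff f p = 0) → IsOrdinaryAt W₀ 2 →
      ∀ (L₀ : PeriodPair), IsNeronLatticeOf (W₀.baseChange ℂ) L₀ →
      ∀ (q : ℚ), q ≠ 0 → (∀ z ∈ periodLattice f, (q : ℂ) * z ∈ L₀.lattice) →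
      (∀ z ∈ L₀.lattice, ∃ w ∈ periodLattice f, z = (q : ℂ) * w) →
      ∀ (x₀ : ℚ), HasRationalTwoTorsionX W₀ x₀ → ¬ TwoTorsionRamifiedAtTwo x₀) :
    ∀ (W₁ : WeierstrassCurve ℚ) [W₁.IsElliptic] [W₁.IsGloballyMinimal]
      ⦃N : ℕ⦄ [NeZero N] (f : CuspForm (CongruenceSubgroup.Gamma0 N) 2), IsNewformOf W₁ f →
      ¬ 2 ∣ N → (∃ p : ℕ, p.Prime ∧ p ∣ N ∧ cuspCoeff f p = 0) → IsOrdinaryAt W₁ 2 →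
      ∀ (L₁ : PeriodPair), IsNeronLatticeOf (W₁.baseChange ℂ) L₁ →
      ∀ (c₁ : ℚ), c₁ ≠ 0 → (∀ z ∈ periodLatticeGamma1 f, (c₁ : ℂ) * z ∈ L₁.lattice) →
      (∀ z ∈ L₁.lattice, ∃ w ∈ periodLatticeGamma1 f, z = (c₁ : ℂ) * w) →
      ∀ (x₁ : ℚ), HasRationalTwoTorsionX W₁ x₁ → ¬ TwoTorsionRamifiedAtTwo x₁ := by
  intro W₁ _ _ N _ f hW₁ hodd hpex hord₁ L₁ hL₁ c₁ hc₁ hin₁ hout₁ x₁ hx₁ hram₁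
  obtain ⟨p, hp, hpN, hap⟩ := hpex
  have hp2 : p ≠ 2 := by
    rintro rfl
    exact hodd hpN
  -- the `X₀(N)`-optimal curve of the class
  have hout₁' : ∀ z ∈ L₁.lattice, ∃ w ∈ periodLattice f, z = (c₁ : ℂ) * w := fun z hz ↦ by
    obtain ⟨w, hw, rfl⟩ := hout₁ z hz
    exact ⟨w, periodLatticeGamma1_le_periodLattice f hw, rfl⟩
  obtain ⟨W₀, _i₀, _m₀, L₀, q, hW₀, hL₀, hq, hin₀, hout₀, hiso⟩ :=
    exists_gamma0Optimal_of_gamma1Lattice W₁ f hW₁ hL₁ hc₁ hout₁'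
  have hord₀ : IsOrdinaryAt W₀ 2 :=
    Summit.BirchSwinnertonDyer.BirchSwinnertonDyer.Theorems.IsogenyMuShift.isOrdinaryAt_of_isIsogenous hiso hord₁
  -- P-E₀ at `W₀`
  have hno₀ : ¬ ∃ x₀ : ℚ, HasRationalTwoTorsionX W₀ x₀ ∧ TwoTorsionRamifiedAtTwo x₀ := by
    rintro ⟨x₀, hx₀, hram₀⟩
    exact hP W₀ f hW₀ hodd ⟨p, hp, hpN, hap⟩ hord₀ L₀ hL₀ q hq hin₀ hout₀ x₀ hx₀ hram₀
  -- climb the odd cover `W₁ → W₀`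
  exact not_exists_ramified_of_gamma0Optimal W₀ W₁ hord₁ f hW₁.1 hp hp2 hpN hap hL₀ hL₁ hq hc₁ hin₀ hout₀
    hin₁ hout₁ hno₀ ⟨x₁, hx₁, hram₁⟩

end Summit.BirchSwinnertonDyer.BirchSwinnertonDyer.Theorems.DepletionAtTwo.ShimuraCoverConverse

end
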